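import Literature.Probability.Percolation.KohlerSchindlerTassionRSWFunctions
import Mathlib.Data.Nat.Log
import HarnessLib

/-!
# Köhler-Schindler–Tassion, §5.2: the renormalisation scheme — Theorem 1 from Lemmas 1, 3, 4, 5,
duality and the scale-one estimate (proofs only)

Topic `Literature/Probability/Percolation`; sibling of `KohlerSchindlerTassionRSW.lean` (the named fact
`KohlerSchindlerTassion2023_thm1` — Theorem 1 of [KohlerSchindlerTassion2023], REFUTED as vendored
because it omits the nearest-neighbour support of the paper's configuration space — and the corrected
restatement described there) and of `KohlerSchindlerTassionRSWFunctions.lean` (§5.1). This file is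
§5.2 of the paper, "Proof of Theorem 1 … based on Lemmas 1–5 and their corresponding dual results",
formalised as a fully proved ABSTRACT reduction: from real sequences indexed by the scale — the
crossing, arm, bridge and quasi-crossing probabilities of a percolation measure and of its dual —
satisfying the inequalities printed as Lemma 1 (i)–(iii), Lemma 3, Lemma 4, Lemma 5, the duality
relation (2), monotonicity of crossing probabilities in the rectangle, `𝓑(n) ⊇ 𝓒(2n, n)` and the
scale-one estimate, it derives the relation (∗) `b(n) ≥ f(1 - b*(n))` along `n = 4^i` and then the
conclusion of Theorem 1, `P[𝓒(ρn, n)] ≥ ψ_ρ(P[𝓒(n, ρn)])` for all real `ρ ≥ 1` and `n ≥ 1`, with an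
EXPLICIT universal homeomorphism `ψ_ρ = f_1^[2⌈ρ⌉ + 13]` of `[0, 1]`. What remains for the corrected
Theorem 1 itself are the measure-theoretic / planar-topological inputs (Lemmas 1–5 for a
nearest-neighbour, invariant, positively associated measure on `ℤ²` and its dual), which are NOT here.

## Source (arXiv:2011.04618 = Duke Math. J. 172 (2023)), the inputs as printed

With `a(n) = P[𝓐(n)]`, `b(n) = P[𝓑(n)]` (arm and bridge events, §1), `q(n, m) = P[𝓠(n, m)]`
(quasi-crossings, §4.1), `b*`, `a*`, `q*`, `𝓒*` their dual analogues, `f_1(x) = (1-(1-x)^{1/2000})^{2000}`: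
* (2) "`P[𝓒(m,n)] = 1 - P[𝓒*(n,m)]`";
* Lemma 1: "(i) `P[𝓒(8n,n)] ≥ f_1(b(n))`, (ii) `a(n) ≥ f_1(P[𝓒(n,8n)])`, (iii)
  `P[𝓒(ρn,n)] ≥ P[𝓒(2n,n)]^{2ρ-1}` for every integer `ρ ≥ 1`";
* Lemma 3: "Let `m = 4^j` for some `j ≥ 0`. We have `q(4m,m) ≥ (min_{ℓ ∈ [m,4m]} a(ℓ))^6`";
* Lemma 4: "For all `m ≥ ℓ ≥ k ≥ 1`, `max{q(m,k), (1-(1-b(ℓ))²)/q(ℓ,k)} ≥ 1-(1-q(m,ℓ))^{1/2}`", in the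
  division-free form its proof gives ((8): `max{q(m,k), P[𝓔]} ≥ 1 - (1 - q(m,ℓ))^{1/2}`, (9) and the
  display after it: `P[𝓔]·q(ℓ,k) ≤ P[𝓔 ∩ 𝓠(ℓ,k)] ≤ 1 - (1 - b(ℓ))²`);
* Lemma 5: "For all `m ≥ ℓ ≥ 1`, we have `b(m) ≥ q(m, ℓ) · b(ℓ)`";
* §5.2: "Using that `b*(m_k) ≥ P[𝓒*(2m_k, m_k)]`", "`P[𝓒(8m_{k-1}, m_{k-1})] ≤ b(m_k)`" (bridges contain
  long crossings; crossing probabilities are monotone in the rectangle, "by inclusion of events"), and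
  "The scale `m_0` is well-defined since `b(1) ≥ f_1(1 - b*(1))`".

## What is here (namespace `Literature.Probability.Percolation.KST2023`)

* `KST2023.SchemeHyp g j₁ c c' a a' b b' q q'` — the hypothesis structure: `c m n`, `c' m n` (primal
  and dual crossing probabilities `P[𝓒(m,n)]`, `P[𝓒*(m,n)]`), `a`, `a'`, `b`, `b'`, `q`, `q'` as above,
  an admissible bookkeeping function `g` (the paper's `f_1`; `KST2023.IsAdmissible`), and a threshold
  exponent `j₁` (the paper has `j₁ = 0`): the inputs listed above, required ONLY at the scales the proof
  visits (powers of `4` at least `4^{j₁}`, arms at all `ℓ ≥ 4^{j₁}`; duality, monotonicity and the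
  standard gluing (iii) at all scales), plus the scale-`4^{j₁}` estimate `b(4^{j₁}) ≥ g^[9](1 - b*(4^{j₁}))`.
  `SchemeHyp.symm`: the hypotheses are symmetric under primal ↔ dual (Remark 3 of the paper).
* PROVED: `SchemeHyp.quasi_consecutive` ((15): `q(m_k, m_{k-1}) ≥ g^[4](1 - b*(m_k))`),
  `SchemeHyp.core` (the induction (14): `q(m_k, m_0) ≥ g^[5](1 - b*(m_k))` along bad scales),
  `SchemeHyp.sq_le_bridge` (`b(n) ≥ b(m_0)²`), `SchemeHyp.bridge_ge` (**(∗)**: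
  `b(4^i) ≥ g^[11](1 - b*(4^i))` for all `i ≥ j₁`), `SchemeHyp.long_ge_pow4` / `SchemeHyp.long_ge`
  (`P[𝓒(2n,n)] ≥ g^[13](P[𝓒(n,2n)])`), `SchemeHyp.short_ge` (dual gluing), and **`SchemeHyp.thm1`**:
  `P[𝓒(⌊ρn⌋, n)] ≥ g^[2⌈ρ⌉+13](P[𝓒(n, ⌊ρn⌋)])` for real `ρ ≥ 1`, `n ≥ 1`; `SchemeHyp.thm1_homeomorph`,
  `SchemeHyp.thm1_rootPow`, `SchemeHyp.exists_homeomorph` — the same in the shape of the tree's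
  statement of Theorem 1 (`ψ (Set.projIcc 0 1 _ (P[𝓒(n, ⌊ρn⌋)])) ≤ P[𝓒(⌊ρn⌋, n)]` with
  `ψ = KST2023.iterHomeo (KST2023.rootPowHomeo N _) (2⌈ρ⌉₊ + 13) : unitInterval ≃ₜ unitInterval`,
  chosen before the data).

## Design choices (documented deviations from the printed bookkeeping; the ARGUMENT is the paper's)

* The paper's family `f_i` and constants (`f_2`, `f_4`, `f_18`, `f_20`; `ψ_2 = f_1 ∘ f_20 ∘ f_1`) are
  replaced by the compositional iterates `g^[k]` of `g = f_1` (constants `4, 5, 9, 11`;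
  `ψ_2 = g^[13]`), which makes (12) `f_i ∘ f_i ≥ f_{2i}` an identity and (13) unnecessary — see the
  module docstring of `KohlerSchindlerTassionRSWFunctions.lean`. Where the paper writes "strictly
  smaller than `f_4(1 - b*(m_k))` due to (13)" the strictness is taken, as it must be at the endpoint,
  from the strict inequality `b(m_k) < f(1 - b*(m_k))` defining a bad scale.
* Lemma 3 is consumed with exponent `8 ≥ 6` (weaker: `t ≤ a(ℓ) ≤ 1` gives `t^8 ≤ t^6`), Lemma 1 (iii)
  with `ρ = r + 1` (no `ℕ`-subtraction), Lemma 4 division-free (no `x / 0`).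
* General real `ρ`: "For general `ρ`, we conclude using the standard gluing construction (see part
  (iii) in Lemma 1)" is made explicit as `P[𝓒(⌊ρn⌋,n)] ≥ P[𝓒(⌈ρ⌉n,n)] ≥ P[𝓒(2n,n)]^{2⌈ρ⌉-1}` and, on
  the short side, the DUAL gluing `P[𝓒(n,2n)] ≥ g^[⌈ρ⌉](P[𝓒(n,⌈ρ⌉n)])` (`SchemeHyp.short_ge`, from
  (iii) for the dual and `1 - x ≤ (1 - g^[r] x)^{2^r}`); powers `y^{2r-1} ≥ g^[r](y)`. Hence
  `ψ_ρ = g^[2⌈ρ⌉+13]`.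
* Threshold `j₁`: the renormalisation inputs are only required from scale `4^{j₁}` on (rounding of
  `αn`, `βn` at small scales is then the instantiator's choice), at the price of the hypothesis
  `hsmall` of `thm1`/`long_ge` — the aspect-ratio-2 inequality at the finitely many scales below
  `4^{j₁}`, which for a percolation measure follows from edge counting
  (`KST2023.iterate_rootPow_one_sub_pow_le`); `j₁ = 0` is the paper's setting (`hsmall` vacuous,
  `SchemeHyp.thm1₀`).
* Nothing here is a named fact; the file adds no hypothesis to the tree's debt. The instantiation
  (definition of arms, bridges, quasi-crossings on `BondConfig (Site 2)` and the proofs of Lemmas 1–5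
  and of duality for nearest-neighbour invariant positively associated measures) is future work
  recorded in `KohlerSchindlerTassionRSW.lean`'s erratum.

## References

* [KohlerSchindlerTassion2023] L. Köhler-Schindler, V. Tassion, *Crossing probabilities for planar
  percolation*, Duke Math. J. 172 (2023) 809–838 (arXiv:2011.04618), §1 (2), §3 Lemma 1, §4 Lemmas 3–5,
  §5.2 (proof of Theorem 1), Remark 3.
-/

namespace Literature.Probability.Percolation

namespace KST2023

open Set

noncomputable section

/-- **The inputs of §5.2** for an admissible bookkeeping function `g` (the paper's `f_1`), a threshold
exponent `j₁` (the paper: `j₁ = 0`) and real sequences `c m n = P[𝓒(m,n)]`, `c' m n = P[𝓒*(m,n)]`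
(primal / dual horizontal crossings of `R(m,n) = [-m,m]×[-n,n]`), `a n = P[𝓐(n)]`, `b n = P[𝓑(n)]`,
`q n m = P[𝓠(n,m)]` and their dual analogues `a'`, `b'`, `q'`: ranges in `[0,1]`; the duality (2)
`P[𝓒(m,n)] = 1 - P[𝓒*(n,m)]`; monotonicity of crossing probabilities in the rectangle; Lemma 1 (i)
`P[𝓒(8n,n)] ≥ f_1(b(n))`, (ii) `a(n) ≥ f_1(P[𝓒(n,8n)])`, (iii) `P[𝓒(ρn,n)] ≥ P[𝓒(2n,n)]^{2ρ-1}`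
(`ρ = r+1`); `b(n) ≥ P[𝓒(2n,n)]`; Lemma 3 `q(4m,m) ≥ (min_{ℓ∈[m,4m]} a(ℓ))^6` (consumed with exponent
`8`); Lemma 4 in the division-free form `s ≤ q(m,k) ∨ s·q(ℓ,k) ≤ 1-(1-b(ℓ))²`,
`s = 1-(1-q(m,ℓ))^{1/2}`; Lemma 5 `b(m) ≥ q(m,ℓ) b(ℓ)`; each for the primal and the dual quantities, and
only at the scales the proof visits (powers of `4` from `4^{j₁}` on); and the estimate
`b(4^{j₁}) ≥ g^[9](1 - b*(4^{j₁}))` making the first good scale `m_0` well defined ("since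
`b(1) ≥ f(1-b*(1))`"). [cite: KohlerSchindlerTassion2023, §5.2] -/
structure SchemeHyp (g : ℝ → ℝ) (j₁ : ℕ) (c c' : ℕ → ℕ → ℝ) (a a' b b' : ℕ → ℝ)
    (q q' : ℕ → ℕ → ℝ) : Prop where
  /-- `P[𝓒(m,n)] ∈ [0,1]`. -/
  c_mem : ∀ m n, c m n ∈ Icc (0 : ℝ) 1
  /-- `P[𝓒*(m,n)] ∈ [0,1]`. -/
  c'_mem : ∀ m n, c' m n ∈ Icc (0 : ℝ) 1
  /-- `b(n) ∈ [0,1]`. -/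
  b_mem : ∀ n, b n ∈ Icc (0 : ℝ) 1
  /-- `b*(n) ∈ [0,1]`. -/
  b'_mem : ∀ n, b' n ∈ Icc (0 : ℝ) 1
  /-- `q(n,m) ∈ [0,1]`. -/
  q_mem : ∀ m n, q m n ∈ Icc (0 : ℝ) 1
  /-- `q*(n,m) ∈ [0,1]`. -/
  q'_mem : ∀ m n, q' m n ∈ Icc (0 : ℝ) 1
  /-- Duality (2): `P[𝓒(m,n)] + P[𝓒*(n,m)] = 1`. -/
  dual : ∀ m n, 1 ≤ m → 1 ≤ n → c m n + c' n m = 1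
  /-- Wider rectangles are harder to cross: `P[𝓒(m',n)] ≤ P[𝓒(m,n)]` for `m ≤ m'`. -/
  c_anti_left : ∀ ⦃m m' n : ℕ⦄, 1 ≤ m → m ≤ m' → 1 ≤ n → c m' n ≤ c m n
  /-- Taller rectangles are easier to cross: `P[𝓒(m,n)] ≤ P[𝓒(m,n')]` for `n ≤ n'`. -/
  c_mono_right : ∀ ⦃m n n' : ℕ⦄, 1 ≤ m → 1 ≤ n → n ≤ n' → c m n ≤ c m n'
  /-- Dual of `c_anti_left`. -/
  c'_anti_left : ∀ ⦃m m' n : ℕ⦄, 1 ≤ m → m ≤ m' → 1 ≤ n → c' m' n ≤ c' m n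
  /-- Dual of `c_mono_right`. -/
  c'_mono_right : ∀ ⦃m n n' : ℕ⦄, 1 ≤ m → 1 ≤ n → n ≤ n' → c' m n ≤ c' m n'
  /-- Lemma 1 (iii), `ρ = r + 1`: `P[𝓒(2n,n)]^{2r+1} ≤ P[𝓒((r+1)n, n)]`. -/
  glue : ∀ r n : ℕ, 1 ≤ n → c (2 * n) n ^ (2 * r + 1) ≤ c ((r + 1) * n) n
  /-- Lemma 1 (iii) for the dual. -/
  glue' : ∀ r n : ℕ, 1 ≤ n → c' (2 * n) n ^ (2 * r + 1) ≤ c' ((r + 1) * n) n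
  /-- Lemma 1 (i) at the scales `4^j`, `j ≥ j₁`: `g(b(n)) ≤ P[𝓒(8n,n)]`. -/
  long_of_bridge : ∀ j, j₁ ≤ j → g (b (4 ^ j)) ≤ c (8 * 4 ^ j) (4 ^ j)
  /-- Lemma 1 (i) for the dual. -/
  long_of_bridge' : ∀ j, j₁ ≤ j → g (b' (4 ^ j)) ≤ c' (8 * 4 ^ j) (4 ^ j)
  /-- Lemma 1 (ii) at every scale `ℓ ≥ 4^{j₁}`: `g(P[𝓒(ℓ,8ℓ)]) ≤ a(ℓ)`. -/
  arm_of_short : ∀ ℓ, 4 ^ j₁ ≤ ℓ → g (c ℓ (8 * ℓ)) ≤ a ℓ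
  /-- Lemma 1 (ii) for the dual. -/
  arm_of_short' : ∀ ℓ, 4 ^ j₁ ≤ ℓ → g (c' ℓ (8 * ℓ)) ≤ a' ℓ
  /-- Bridges contain long crossings, at the scales `4^j`, `j ≥ j₁`: `P[𝓒(2n,n)] ≤ b(n)`. -/
  long_le_bridge : ∀ j, j₁ ≤ j → c (2 * 4 ^ j) (4 ^ j) ≤ b (4 ^ j)
  /-- The same for the dual. -/
  long_le_bridge' : ∀ j, j₁ ≤ j → c' (2 * 4 ^ j) (4 ^ j) ≤ b' (4 ^ j)
  /-- Lemma 3 (with exponent `8 ≥ 6`): a common lower bound `t ≥ 0` of the arm probabilities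
  `a(ℓ)`, `ℓ ∈ [4^j, 4^{j+1}]`, gives `t^8 ≤ q(4^{j+1}, 4^j)` (`j ≥ j₁`). -/
  quasi_of_arms : ∀ (j : ℕ) (t : ℝ), j₁ ≤ j → 0 ≤ t →
    (∀ ℓ, 4 ^ j ≤ ℓ → ℓ ≤ 4 ^ (j + 1) → t ≤ a ℓ) → t ^ 8 ≤ q (4 ^ (j + 1)) (4 ^ j)
  /-- Lemma 3 for the dual. -/
  quasi_of_arms' : ∀ (j : ℕ) (t : ℝ), j₁ ≤ j → 0 ≤ t →
    (∀ ℓ, 4 ^ j ≤ ℓ → ℓ ≤ 4 ^ (j + 1) → t ≤ a' ℓ) → t ^ 8 ≤ q' (4 ^ (j + 1)) (4 ^ j)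
  /-- Lemma 4 (cascading), division-free, at scales `4^i ≥ 4^j ≥ 4^k ≥ 4^{j₁}`: with
  `s = 1 - (1 - q(m,ℓ))^{1/2}`, either `s ≤ q(m,k)` or `s · q(ℓ,k) ≤ 1 - (1 - b(ℓ))²`. -/
  cascade : ∀ i j k : ℕ, j₁ ≤ k → k ≤ j → j ≤ i →
    1 - Real.sqrt (1 - q (4 ^ i) (4 ^ j)) ≤ q (4 ^ i) (4 ^ k) ∨
      (1 - Real.sqrt (1 - q (4 ^ i) (4 ^ j))) * q (4 ^ j) (4 ^ k) ≤ 1 - (1 - b (4 ^ j)) ^ 2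
  /-- Lemma 4 for the dual. -/
  cascade' : ∀ i j k : ℕ, j₁ ≤ k → k ≤ j → j ≤ i →
    1 - Real.sqrt (1 - q' (4 ^ i) (4 ^ j)) ≤ q' (4 ^ i) (4 ^ k) ∨
      (1 - Real.sqrt (1 - q' (4 ^ i) (4 ^ j))) * q' (4 ^ j) (4 ^ k) ≤ 1 - (1 - b' (4 ^ j)) ^ 2
  /-- Lemma 5 (closing) at scales `4^i ≥ 4^k ≥ 4^{j₁}`: `q(m,ℓ) · b(ℓ) ≤ b(m)`. -/
  closing : ∀ i k : ℕ, j₁ ≤ k → k ≤ i → q (4 ^ i) (4 ^ k) * b (4 ^ k) ≤ b (4 ^ i)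
  /-- Lemma 5 for the dual. -/
  closing' : ∀ i k : ℕ, j₁ ≤ k → k ≤ i → q' (4 ^ i) (4 ^ k) * b' (4 ^ k) ≤ b' (4 ^ i)
  /-- The first scale is good: `g^[9](1 - b*(4^{j₁})) ≤ b(4^{j₁})`. -/
  init : g^[9] (1 - b' (4 ^ j₁)) ≤ b (4 ^ j₁)

namespace SchemeHyp

variable {g : ℝ → ℝ} {j₁ : ℕ} {c c' : ℕ → ℕ → ℝ} {a a' b b' : ℕ → ℝ} {q q' : ℕ → ℕ → ℝ}

/-- `1 ≤ 4^j`. [folklore] -/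
theorem one_le_pow4 (j : ℕ) : 1 ≤ 4 ^ j := Nat.one_le_pow _ _ (by norm_num)

/-- **Primal–dual symmetry of the inputs** ("the roles of primal and dual can be exchanged", Remark 3;
the scale-one estimate passes to the dual by the duality (11) of `g^[9]`).
[cite: KohlerSchindlerTassion2023, §5.2 Remark 3] -/
theorem symm (hg : IsAdmissible g) (H : SchemeHyp g j₁ c c' a a' b b' q q') :
    SchemeHyp g j₁ c' c a' a b' b q' q where
  c_mem := H.c'_mem
  c'_mem := H.c_mem
  b_mem := H.b'_mem
  b'_mem := H.b_mem
  q_mem := H.q'_mem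
  q'_mem := H.q_mem
  dual m n hm hn := by rw [add_comm]; exact H.dual n m hn hm
  c_anti_left := H.c'_anti_left
  c_mono_right := H.c'_mono_right
  c'_anti_left := H.c_anti_left
  c'_mono_right := H.c_mono_right
  glue := H.glue'
  glue' := H.glue
  long_of_bridge := H.long_of_bridge'
  long_of_bridge' := H.long_of_bridge
  arm_of_short := H.arm_of_short'
  arm_of_short' := H.arm_of_short
  long_le_bridge := H.long_le_bridge'
  long_le_bridge' := H.long_le_bridge
  quasi_of_arms := H.quasi_of_arms'
  quasi_of_arms' := H.quasi_of_arms
  cascade := H.cascade'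
  cascade' := H.cascade
  closing := H.closing'
  closing' := H.closing
  init := hg.iterate_dual 9 (H.b_mem _) (H.b'_mem _) H.init

/-- **(15): the quasi-crossing between consecutive scales**, `q(4^{j+1}, 4^j) ≥ g^[4](1 - b*(4^{j+1}))`
("by Lemma 3, `q(m_k, m_{k-1}) ≥ min_{ℓ} a(ℓ)^6`, and by Lemma 1,
`a(ℓ) ≥ f_1(P[𝓒(ℓ,8ℓ)]) ≥ f_1(P[𝓒(m_k,2m_k)]) = f_1(1 - P[𝓒*(2m_k,m_k)])` … Using that
`b*(m_k) ≥ P[𝓒*(2m_k,m_k)]`, we obtain `q(m_k, m_{k-1}) ≥ f_2(1 - b*(m_k))`").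
[cite: KohlerSchindlerTassion2023, §5.2 (15)] -/
theorem quasi_consecutive (hg : IsAdmissible g) (H : SchemeHyp g j₁ c c' a a' b b' q q') {j : ℕ}
    (hj : j₁ ≤ j) : g^[4] (1 - b' (4 ^ (j + 1))) ≤ q (4 ^ (j + 1)) (4 ^ j) := by
  set M := 4 ^ (j + 1) with hM
  have hM1 : 1 ≤ M := one_le_pow4 _
  have hy : 1 - b' M ∈ Icc (0 : ℝ) 1 := Icc.one_sub_mem (H.b'_mem M)
  have hgy : g (1 - b' M) ∈ Icc (0 : ℝ) 1 := hg.mem_Icc hy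
  -- every arm probability in `[4^j, 4^(j+1)]` is at least `g (1 - b*(M))`
  have harm : ∀ ℓ, 4 ^ j ≤ ℓ → ℓ ≤ 4 ^ (j + 1) → g (1 - b' M) ≤ a ℓ := by
    intro ℓ h1 h2
    have hℓ1 : 1 ≤ ℓ := (one_le_pow4 j).trans h1
    have hℓ : 4 ^ j₁ ≤ ℓ := (Nat.pow_le_pow_right (by norm_num) hj).trans h1
    refine le_trans (hg.mono ?_) (H.arm_of_short ℓ hℓ)
    -- `1 - b*(M) ≤ P[𝓒(M, 2M)] ≤ P[𝓒(M, 8ℓ)] ≤ P[𝓒(ℓ, 8ℓ)]`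
    have hd := H.dual M (2 * M) hM1 (by omega)
    have hb := H.long_le_bridge' (j + 1) (by omega)
    rw [← hM] at hb
    calc 1 - b' M ≤ c M (2 * M) := by linarith
      _ ≤ c M (8 * ℓ) := H.c_mono_right hM1 (by omega) (by rw [hM, pow_succ] at *; omega)
      _ ≤ c ℓ (8 * ℓ) := H.c_anti_left hℓ1 h2 (by omega)
  have h8 := H.quasi_of_arms j (g (1 - b' M)) hj hgy.1 harm
  calc g^[4] (1 - b' M) = g^[3] (g (1 - b' M)) := Function.iterate_succ_apply g 3 _
    _ ≤ g (1 - b' M) ^ (2 ^ 3) := hg.iterate_le_pow 3 hgy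
    _ = g (1 - b' M) ^ 8 := by norm_num
    _ ≤ q M (4 ^ j) := h8

/-- **Scale transfer for bridges**, `g(b(4^j)) ≤ b(4^{j+1})` (`j ≥ j₁`): "Lemma 1 via
`f_1(b(m_{k-1})) ≤ P[𝓒(8m_{k-1}, m_{k-1})] ≤ b(m_k)`". [cite: KohlerSchindlerTassion2023, §5.2] -/
theorem g_bridge_le (H : SchemeHyp g j₁ c c' a a' b b' q q') {j : ℕ} (hj : j₁ ≤ j) :
    g (b (4 ^ j)) ≤ b (4 ^ (j + 1)) := by
  have h1 := one_le_pow4 j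
  calc g (b (4 ^ j)) ≤ c (8 * 4 ^ j) (4 ^ j) := H.long_of_bridge j hj
    _ = c (2 * 4 ^ (j + 1)) (4 ^ j) := by rw [pow_succ]; ring_nf
    _ ≤ c (2 * 4 ^ (j + 1)) (4 ^ (j + 1)) :=
        H.c_mono_right (by omega) h1 (Nat.pow_le_pow_right (by norm_num) (by omega))
    _ ≤ b (4 ^ (j + 1)) := H.long_le_bridge (j + 1) (by omega)

/-- **The induction (14)** along a run of bad scales `m_k = 4^{j₀+k}`, `1 ≤ k ≤ K`
(`b(m_k) < g^[9](1 - b*(m_k))`) above a scale `m_0 = 4^{j₀}`, `j₀ ≥ j₁`: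
`q(m_k, m_0) ≥ g^[5](1 - b*(m_k))` for all `1 ≤ k ≤ K` — base case (15), induction step by the
cascading Lemma 4 applied to `(m_k, m_{k-1}, m_0)`, the second alternative being excluded by the
scale transfers of `b`, `b*` (Lemma 1) and the badness of `m_k`.
[cite: KohlerSchindlerTassion2023, §5.2 (14)] -/
theorem core (hg : IsAdmissible g) (H : SchemeHyp g j₁ c c' a a' b b' q q') {j₀ : ℕ} (hj₀ : j₁ ≤ j₀)
    (K : ℕ) (hbad : ∀ k, 1 ≤ k → k ≤ K → b (4 ^ (j₀ + k)) < g^[9] (1 - b' (4 ^ (j₀ + k)))) :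
    ∀ k, 1 ≤ k → k ≤ K → g^[5] (1 - b' (4 ^ (j₀ + k))) ≤ q (4 ^ (j₀ + k)) (4 ^ j₀) := by
  intro k hk hkK
  induction k, hk using Nat.le_induction with
  | base =>
    have hy : 1 - b' (4 ^ (j₀ + 1)) ∈ Icc (0 : ℝ) 1 := Icc.one_sub_mem (H.b'_mem _)
    exact (hg.iterate_succ_le 4 hy).trans (H.quasi_consecutive hg hj₀)
  | succ k hk ih =>
    have ih := ih (by omega)
    set y := 1 - b' (4 ^ (j₀ + (k + 1))) with hy_def
    have hy : y ∈ Icc (0 : ℝ) 1 := Icc.one_sub_mem (H.b'_mem _)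
    have hpow : 4 ^ (j₀ + (k + 1)) = 4 ^ (j₀ + k + 1) := by rw [← add_assoc]
    -- (15) and the square-root trick side: `s ≥ g^[5] y`
    have hS1 : g^[4] y ≤ q (4 ^ (j₀ + (k + 1))) (4 ^ (j₀ + k)) := by
      rw [hy_def, hpow]; exact H.quasi_consecutive hg (by omega)
    have hq1 := H.q_mem (4 ^ (j₀ + (k + 1))) (4 ^ (j₀ + k))
    have hS2 : g^[5] y ≤ 1 - Real.sqrt (1 - q (4 ^ (j₀ + (k + 1))) (4 ^ (j₀ + k))) := by
      refine (hg.iterate_succ_le_one_sub_sqrt 4 hy).trans ?_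
      have := Real.sqrt_le_sqrt
        (by linarith : 1 - q (4 ^ (j₀ + (k + 1))) (4 ^ (j₀ + k)) ≤ 1 - g^[4] y)
      linarith
    -- the cascading alternative
    rcases H.cascade (j₀ + (k + 1)) (j₀ + k) j₀ hj₀ (by omega) (by omega) with h1 | h2
    · exact hS2.trans h1
    · exfalso
      -- scale transfer for `b*`: `1 - b*(m_{k-1}) ≥ g y`, hence `q(m_{k-1}, m_0) ≥ g^[6] y`
      have hy' : 1 - b' (4 ^ (j₀ + k)) ∈ Icc (0 : ℝ) 1 := Icc.one_sub_mem (H.b'_mem _)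
      have hS3 : g y ≤ 1 - b' (4 ^ (j₀ + k)) := by
        have ht : g (b' (4 ^ (j₀ + k))) ≤ b' (4 ^ (j₀ + (k + 1))) := by
          rw [hpow]; exact (H.symm hg).g_bridge_le (by omega)
        have ht' : g (1 - (1 - b' (4 ^ (j₀ + k)))) ≤ 1 - y := by
          rw [sub_sub_cancel, hy_def, sub_sub_cancel]; exact ht
        have := hg.dual (Icc.one_sub_mem hy) hy' ht'
        rwa [sub_sub_cancel] at this
      have hIH : g^[6] y ≤ q (4 ^ (j₀ + k)) (4 ^ j₀) := by
        calc g^[6] y = g^[5] (g y) := Function.iterate_succ_apply g 5 y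
          _ ≤ g^[5] (1 - b' (4 ^ (j₀ + k))) := hg.iterate_mono 5 hS3
          _ ≤ q (4 ^ (j₀ + k)) (4 ^ j₀) := ih
      -- scale transfer for `b` and badness of `m_k`: `b(m_{k-1}) < g^[8] y`
      have hS4 : b (4 ^ (j₀ + k)) < g^[8] y := by
        by_contra hcon
        rw [not_lt] at hcon
        have h9 : g^[9] y ≤ b (4 ^ (j₀ + (k + 1))) := by
          calc g^[9] y = g (g^[8] y) := Function.iterate_succ_apply' g 8 y
            _ ≤ g (b (4 ^ (j₀ + k))) := hg.mono hcon
            _ ≤ b (4 ^ (j₀ + (k + 1))) := by rw [hpow]; exact H.g_bridge_le (by omega)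
        exact absurd (hbad (k + 1) (by omega) hkK) (not_lt.mpr h9)
      -- `1 - (1 - b(m_{k-1}))² < 1 - (1 - g^[8] y)² ≤ g^[7] y ≤ g^[5] y · g^[6] y ≤ s · q(m_{k-1}, m_0)`
      have h8 : g^[8] y ∈ Icc (0 : ℝ) 1 := hg.iterate_mem_Icc 8 hy
      have h7 : g^[7] y ∈ Icc (0 : ℝ) 1 := hg.iterate_mem_Icc 7 hy
      have h6 : g^[6] y ∈ Icc (0 : ℝ) 1 := hg.iterate_mem_Icc 6 hy
      have h5 : g^[5] y ∈ Icc (0 : ℝ) 1 := hg.iterate_mem_Icc 5 hy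
      have hb0 := H.b_mem (4 ^ (j₀ + k))
      have hS5 : 1 - (1 - b (4 ^ (j₀ + k))) ^ 2 < 1 - (1 - g^[8] y) ^ 2 := by
        have : (1 - g^[8] y) ^ 2 < (1 - b (4 ^ (j₀ + k))) ^ 2 :=
          pow_lt_pow_left₀ (by linarith) (by linarith [h8.2]) two_ne_zero
        linarith
      have hS6 : 1 - (1 - g^[8] y) ^ 2 ≤ g^[7] y := by
        have := hg.one_sub_le_sq h7
        rw [← Function.iterate_succ_apply' g 7 y] at this
        linarith
      have hS7 : g^[7] y ≤ g^[5] y * g^[6] y := by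
        calc g^[7] y ≤ (g^[6] y) ^ 2 := hg.iterate_succ_le_sq 6 hy
          _ = g^[6] y * g^[6] y := sq _
          _ ≤ g^[5] y * g^[6] y :=
              mul_le_mul_of_nonneg_right (hg.iterate_succ_le 5 hy) h6.1
      have hfin : g^[5] y * g^[6] y ≤
          (1 - Real.sqrt (1 - q (4 ^ (j₀ + (k + 1))) (4 ^ (j₀ + k)))) *
            q (4 ^ (j₀ + k)) (4 ^ j₀) :=
        mul_le_mul hS2 hIH h6.1 (h5.1.trans hS2)
      linarith

/-- **`b(n) ≥ b(m_0)²`** at the top `n = m_K` of a run of bad scales above `m_0 = 4^{j₀}` ("By (14)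
applied to `k = K`, we have `q(n, m_0) ≥ f_4(1 - b*(n)) ≥ √f_18(1 - b*(n)) ≥ √b(n)` … This bound and
Lemma 5 imply `b(n) ≥ q(n, m_0) b(m_0) ≥ √b(n) b(m_0)`"). [cite: KohlerSchindlerTassion2023, §5.2] -/
theorem sq_le_bridge (hg : IsAdmissible g) (H : SchemeHyp g j₁ c c' a a' b b' q q') {j₀ : ℕ}
    (hj₀ : j₁ ≤ j₀) {K : ℕ} (hK : 1 ≤ K)
    (hbad : ∀ k, 1 ≤ k → k ≤ K → b (4 ^ (j₀ + k)) < g^[9] (1 - b' (4 ^ (j₀ + k)))) :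
    b (4 ^ j₀) ^ 2 ≤ b (4 ^ (j₀ + K)) := by
  have hy : 1 - b' (4 ^ (j₀ + K)) ∈ Icc (0 : ℝ) 1 := Icc.one_sub_mem (H.b'_mem _)
  have h5 : g^[5] (1 - b' (4 ^ (j₀ + K))) ∈ Icc (0 : ℝ) 1 := hg.iterate_mem_Icc 5 hy
  have hq := H.core hg hj₀ K hbad K hK le_rfl
  have hcl := H.closing (j₀ + K) j₀ hj₀ (by omega)
  have hb0 := H.b_mem (4 ^ j₀)
  have h1 : g^[5] (1 - b' (4 ^ (j₀ + K))) * b (4 ^ j₀) ≤ b (4 ^ (j₀ + K)) :=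
    (mul_le_mul_of_nonneg_right hq hb0.1).trans hcl
  have h2 : b (4 ^ (j₀ + K)) < g^[5] (1 - b' (4 ^ (j₀ + K))) ^ 2 :=
    calc b (4 ^ (j₀ + K)) < g^[9] (1 - b' (4 ^ (j₀ + K))) := hbad K hK le_rfl
      _ ≤ g^[6] (1 - b' (4 ^ (j₀ + K))) := hg.iterate_le_iterate (by norm_num) hy
      _ ≤ g^[5] (1 - b' (4 ^ (j₀ + K))) ^ 2 := hg.iterate_succ_le_sq 5 hy
  by_cases hcase : b (4 ^ j₀) ≤ g^[5] (1 - b' (4 ^ (j₀ + K)))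
  · calc b (4 ^ j₀) ^ 2 = b (4 ^ j₀) * b (4 ^ j₀) := sq _
      _ ≤ g^[5] (1 - b' (4 ^ (j₀ + K))) * b (4 ^ j₀) := mul_le_mul_of_nonneg_right hcase hb0.1
      _ ≤ b (4 ^ (j₀ + K)) := h1
  · exfalso
    rw [not_le] at hcase
    have : g^[5] (1 - b' (4 ^ (j₀ + K))) ^ 2 ≤ g^[5] (1 - b' (4 ^ (j₀ + K))) * b (4 ^ j₀) := by
      rw [sq]; exact mul_le_mul_of_nonneg_left hcase.le h5.1
    linarith

/-- **(∗): `b(n) ≥ g^[11](1 - b*(n))` along `n = 4^i`, `i ≥ j₁`** (the paper's `b(n) ≥ f_20(1-b*(n))`):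
choose the last good scale `m_0 = 4^{j₀} ≤ n` (`b(m_0) ≥ g^[9](1 - b*(m_0))`, well defined by `init`);
if `m_0 < n`, then `b(n) ≥ b(m_0)²` and dually `b*(n) ≥ b*(m_0)²`, whence
`b(n) ≥ b(m_0)² ≥ g^[9](1 - b*(m_0))² ≥ g^[9](1 - √b*(n))² ≥ g^[10](1 - b*(n))² ≥ g^[11](1 - b*(n))`.
[cite: KohlerSchindlerTassion2023, §5.2 (∗)] -/
theorem bridge_ge (hg : IsAdmissible g) (H : SchemeHyp g j₁ c c' a a' b b' q q') {i : ℕ}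
    (hi : j₁ ≤ i) : g^[11] (1 - b' (4 ^ i)) ≤ b (4 ^ i) := by
  classical
  -- the last good scale `4^j₀`, `j₁ ≤ j₀ ≤ i`
  let Good : ℕ → Prop := fun j => j₁ ≤ j ∧ g^[9] (1 - b' (4 ^ j)) ≤ b (4 ^ j)
  have hG1 : Good j₁ := ⟨le_rfl, H.init⟩
  set j₀ := Nat.findGreatest Good i with hj₀
  have hj₀i : j₀ ≤ i := Nat.findGreatest_le i
  have hgood : Good j₀ := Nat.findGreatest_spec (P := Good) hi hG1
  have hbad' : ∀ j, j₀ < j → j ≤ i → ¬ Good j := fun j h1 h2 =>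
    Nat.findGreatest_is_greatest h1 h2
  have hyi : 1 - b' (4 ^ i) ∈ Icc (0 : ℝ) 1 := Icc.one_sub_mem (H.b'_mem _)
  rcases Nat.eq_or_lt_of_le hj₀i with heq | hlt
  · -- `n` itself is good
    rw [← heq]
    exact (hg.iterate_le_iterate (by norm_num) (Icc.one_sub_mem (H.b'_mem _))).trans hgood.2
  · obtain ⟨K, hiK⟩ : ∃ K, i = j₀ + K := ⟨i - j₀, by omega⟩
    have hK : 1 ≤ K := by omega
    have hbad : ∀ k, 1 ≤ k → k ≤ K → b (4 ^ (j₀ + k)) < g^[9] (1 - b' (4 ^ (j₀ + k))) :=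
      fun k h1 h2 => not_le.mp fun hle => hbad' (j₀ + k) (by omega) (by omega)
        ⟨hgood.1.trans (by omega), hle⟩
    have hbad2 : ∀ k, 1 ≤ k → k ≤ K → b' (4 ^ (j₀ + k)) < g^[9] (1 - b (4 ^ (j₀ + k))) := by
      intro k h1 h2
      by_contra hcon
      rw [not_lt] at hcon
      exact hbad' (j₀ + k) (by omega) (by omega)
        ⟨hgood.1.trans (by omega), hg.iterate_dual 9 (H.b'_mem _) (H.b_mem _) hcon⟩
    rw [hiK] at hyi ⊢
    -- `b(n) ≥ b(m_0)²` and its dual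
    have hG := H.sq_le_bridge hg hgood.1 hK hbad
    have hG' := (H.symm hg).sq_le_bridge hg hgood.1 hK hbad2
    have hb'0 := H.b'_mem (4 ^ j₀)
    have hs : b' (4 ^ j₀) ≤ Real.sqrt (b' (4 ^ (j₀ + K))) := Real.le_sqrt_of_sq_le hG'
    have hg1 : g (1 - b' (4 ^ (j₀ + K))) ≤ 1 - b' (4 ^ j₀) := by
      have := hg.le_one_sub_sqrt hyi
      rw [sub_sub_cancel] at this
      linarith
    have h9 : g^[9] (1 - b' (4 ^ j₀)) ∈ Icc (0 : ℝ) 1 := hg.iterate_mem_Icc 9 (Icc.one_sub_mem hb'0)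
    calc g^[11] (1 - b' (4 ^ (j₀ + K))) ≤ (g^[10] (1 - b' (4 ^ (j₀ + K)))) ^ 2 :=
          hg.iterate_succ_le_sq 10 hyi
      _ = (g^[9] (g (1 - b' (4 ^ (j₀ + K))))) ^ 2 := by rw [Function.iterate_succ_apply g 9]
      _ ≤ (g^[9] (1 - b' (4 ^ j₀))) ^ 2 :=
          pow_le_pow_left₀ (hg.iterate_mem_Icc 9 (hg.mem_Icc hyi)).1 (hg.iterate_mono 9 hg1) 2
      _ ≤ b (4 ^ j₀) ^ 2 := pow_le_pow_left₀ h9.1 hgood.2 2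
      _ ≤ b (4 ^ (j₀ + K)) := hG

/-- **Theorem 1 at aspect ratio `8` along powers of `4`** (`i ≥ j₁`):
`P[𝓒(8n,n)] ≥ g^[13](P[𝓒(n,8n)])`, `n = 4^i` ("`P[𝓒(8n,n)] ≥ f_1(b(n)) ≥ f_1 ∘ f_20(1 - b*(n)) ≥
f_1 ∘ f_20(1 - f_1⁻¹(P[𝓒*(8n,n)]))`. Then the duality relation (2) implies
`P[𝓒(8n,n)] ≥ ψ_2(P[𝓒(n,8n)])`"). [cite: KohlerSchindlerTassion2023, §5.2] -/
theorem long_ge_pow4 (hg : IsAdmissible g) (H : SchemeHyp g j₁ c c' a a' b b' q q') {i : ℕ}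
    (hi : j₁ ≤ i) : g^[13] (c (4 ^ i) (8 * 4 ^ i)) ≤ c (8 * 4 ^ i) (4 ^ i) := by
  have hN := one_le_pow4 i
  have hyi : 1 - b' (4 ^ i) ∈ Icc (0 : ℝ) 1 := Icc.one_sub_mem (H.b'_mem _)
  have hd := H.dual (4 ^ i) (8 * 4 ^ i) hN (by omega)
  have h1 : g (c (4 ^ i) (8 * 4 ^ i)) ≤ 1 - b' (4 ^ i) := by
    have ht : g (1 - (1 - b' (4 ^ i))) ≤ 1 - c (4 ^ i) (8 * 4 ^ i) := by
      rw [sub_sub_cancel]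
      have := H.long_of_bridge' i hi
      linarith
    have := hg.dual (Icc.one_sub_mem (H.c_mem _ _)) hyi ht
    rwa [sub_sub_cancel] at this
  calc g^[13] (c (4 ^ i) (8 * 4 ^ i)) = g^[12] (g (c (4 ^ i) (8 * 4 ^ i))) :=
        Function.iterate_succ_apply g 12 _
    _ ≤ g^[12] (1 - b' (4 ^ i)) := hg.iterate_mono 12 h1
    _ = g (g^[11] (1 - b' (4 ^ i))) := Function.iterate_succ_apply' g 11 _
    _ ≤ g (b (4 ^ i)) := hg.mono (H.bridge_ge hg hi)
    _ ≤ c (8 * 4 ^ i) (4 ^ i) := H.long_of_bridge i hi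

/-- **Theorem 1 at aspect ratio `2`, every scale `n ≥ 1`**: `P[𝓒(2n,n)] ≥ g^[13](P[𝓒(n,2n)])`
("For general `n`, we obtain `P[𝓒(2n,n)] ≥ ψ_2(P[𝓒(n,2n)])` by inclusion of events"), given the
inequality `hsmall` at the finitely many scales below the threshold `4^{j₁}` (vacuous for `j₁ = 0`).
[cite: KohlerSchindlerTassion2023, §5.2] -/
theorem long_ge (hg : IsAdmissible g) (H : SchemeHyp g j₁ c c' a a' b b' q q')
    (hsmall : ∀ n, 1 ≤ n → n < 4 ^ j₁ → g^[13] (c n (2 * n)) ≤ c (2 * n) n) {n : ℕ} (hn : 1 ≤ n) :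
    g^[13] (c n (2 * n)) ≤ c (2 * n) n := by
  rcases lt_or_ge n (4 ^ j₁) with hlt | hge
  · exact hsmall n hn hlt
  -- `N = 4^i ≤ n < 4N` with `i ≥ j₁`
  set i := Nat.log 4 n with hi
  have hNn : 4 ^ i ≤ n := Nat.pow_log_le_self 4 (by omega)
  have hn4 : n < 4 ^ (i + 1) := Nat.lt_pow_succ_log_self (by norm_num) n
  have hij : j₁ ≤ i := Nat.le_log_of_pow_le (by norm_num) hge
  have hN := one_le_pow4 i
  rw [pow_succ] at hn4
  calc g^[13] (c n (2 * n)) ≤ g^[13] (c (4 ^ i) (8 * 4 ^ i)) := by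
        refine hg.iterate_mono 13 ?_
        calc c n (2 * n) ≤ c n (8 * 4 ^ i) := H.c_mono_right hn (by omega) (by omega)
          _ ≤ c (4 ^ i) (8 * 4 ^ i) := H.c_anti_left hN hNn (by omega)
    _ ≤ c (8 * 4 ^ i) (4 ^ i) := H.long_ge_pow4 hg hij
    _ ≤ c (8 * 4 ^ i) n := H.c_mono_right (by omega) hN hNn
    _ ≤ c (2 * n) n := H.c_anti_left (by omega) (by omega) hn

/-- `2r + 1 ≤ 2^{r+1}`. [folklore] -/
theorem two_mul_add_one_le_two_pow (r : ℕ) : 2 * r + 1 ≤ 2 ^ (r + 1) := by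
  have := Nat.lt_two_pow_self (n := r)
  rw [pow_succ]; omega

/-- **Short crossings of taller rectangles by DUAL gluing**:
`P[𝓒(n,2n)] ≥ g^[r+1](P[𝓒(n,(r+1)n)])` — Lemma 1 (iii) for the dual reads
`(1 - P[𝓒(n,2n)])^{2r+1} ≤ 1 - P[𝓒(n,(r+1)n)]`, and `1 - x ≤ (1 - g^[r+1] x)^{2^{r+1}}`,
`2r + 1 ≤ 2^{r+1}`. [cite: KohlerSchindlerTassion2023, §5.2 and Lemma 1 (iii)] -/
theorem short_ge (hg : IsAdmissible g) (H : SchemeHyp g j₁ c c' a a' b b' q q') (r : ℕ) {n : ℕ}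
    (hn : 1 ≤ n) : g^[r + 1] (c n ((r + 1) * n)) ≤ c n (2 * n) := by
  set u := c n (2 * n) with hu
  set v := c n ((r + 1) * n) with hv
  have huI : u ∈ Icc (0 : ℝ) 1 := H.c_mem _ _
  have hvI : v ∈ Icc (0 : ℝ) 1 := H.c_mem _ _
  have hglue : (1 - u) ^ (2 * r + 1) ≤ 1 - v := by
    have h := H.glue' r n hn
    have h1 := H.dual n (2 * n) hn (by omega)
    have h2 := H.dual n ((r + 1) * n) hn (Nat.mul_pos (by omega) hn)
    have e1 : c' (2 * n) n = 1 - u := by rw [hu]; linarith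
    have e2 : c' ((r + 1) * n) n = 1 - v := by rw [hv]; linarith
    rwa [e1, e2] at h
  by_contra hcon
  rw [not_le] at hcon
  have hr : 2 * r + 1 ≤ 2 ^ (r + 1) := two_mul_add_one_le_two_pow r
  have hgv := hg.iterate_mem_Icc (r + 1) hvI
  have h1 : (1 - u) ^ (2 ^ (r + 1)) ≤ (1 - u) ^ (2 * r + 1) :=
    pow_le_pow_of_le_one (by linarith [huI.2]) (by linarith [huI.1]) hr
  have h2 : (1 - g^[r + 1] v) ^ (2 ^ (r + 1)) < (1 - u) ^ (2 ^ (r + 1)) :=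
    pow_lt_pow_left₀ (by linarith) (by linarith [hgv.2]) (pow_ne_zero _ two_ne_zero)
  have h3 : 1 - v ≤ (1 - g^[r + 1] v) ^ (2 ^ (r + 1)) := hg.one_sub_le_pow_iterate (r + 1) hvI
  linarith

/-- **Theorem 1 (abstract form).** For real `ρ ≥ 1` and every scale `n ≥ 1`,
`P[𝓒(⌊ρn⌋, n)] ≥ ψ_ρ(P[𝓒(n, ⌊ρn⌋)])` with the universal function `ψ_ρ = g^[2⌈ρ⌉ + 13]` ("which
completes the deduction of Theorem 1 from (∗) for `ρ = 2`. For general `ρ`, we conclude using the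
standard gluing construction (see part (iii) in Lemma 1)": here `P[𝓒(⌊ρn⌋,n)] ≥ P[𝓒(⌈ρ⌉n,n)] ≥
P[𝓒(2n,n)]^{2⌈ρ⌉-1} ≥ (g^[13] P[𝓒(n,2n)])^{2^{⌈ρ⌉}} ≥ g^[⌈ρ⌉+13](P[𝓒(n,2n)])` and
`P[𝓒(n,2n)] ≥ g^[⌈ρ⌉](P[𝓒(n,⌈ρ⌉n)]) ≥ g^[⌈ρ⌉](P[𝓒(n,⌊ρn⌋)])` by `short_ge`), given the inequality
`hsmall` below the threshold scale `4^{j₁}` (vacuous for the paper's `j₁ = 0`, see `thm1₀`).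
[cite: KohlerSchindlerTassion2023, Theorem 1 and §5.2] -/
theorem thm1 (hg : IsAdmissible g) (H : SchemeHyp g j₁ c c' a a' b b' q q')
    (hsmall : ∀ n, 1 ≤ n → n < 4 ^ j₁ → g^[13] (c n (2 * n)) ≤ c (2 * n) n) {ρ : ℝ} (hρ : 1 ≤ ρ)
    {n : ℕ} (hn : 1 ≤ n) :
    g^[2 * ⌈ρ⌉₊ + 13] (c n ⌊ρ * n⌋₊) ≤ c ⌊ρ * n⌋₊ n := by
  obtain ⟨r, hr⟩ : ∃ r : ℕ, ⌈ρ⌉₊ = r + 1 :=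
    ⟨⌈ρ⌉₊ - 1, (Nat.sub_add_cancel (Nat.one_le_ceil_iff.mpr (by linarith))).symm⟩
  set M := ⌊ρ * n⌋₊ with hM
  have hn0 : (0 : ℝ) ≤ n := Nat.cast_nonneg n
  have hnM : n ≤ M := by
    rw [hM, Nat.le_floor_iff (by positivity)]
    calc (n : ℝ) = 1 * n := (one_mul _).symm
      _ ≤ ρ * n := mul_le_mul_of_nonneg_right hρ hn0
  have hM1 : 1 ≤ M := hn.trans hnM
  have hMr : M ≤ (r + 1) * n := by
    rw [hM]
    refine Nat.floor_le_of_le ?_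
    calc ρ * n ≤ (⌈ρ⌉₊ : ℝ) * n := mul_le_mul_of_nonneg_right (Nat.le_ceil ρ) hn0
      _ = (((r + 1) * n : ℕ) : ℝ) := by rw [hr]; push_cast; ring
  have hu : c n (2 * n) ∈ Icc (0 : ℝ) 1 := H.c_mem _ _
  have h13 : g^[13] (c n (2 * n)) ∈ Icc (0 : ℝ) 1 := hg.iterate_mem_Icc 13 hu
  have hpow : 2 * r + 1 ≤ 2 ^ (r + 1) := two_mul_add_one_le_two_pow r
  rw [hr]
  calc g^[2 * (r + 1) + 13] (c n M)
        ≤ g^[2 * (r + 1) + 13] (c n ((r + 1) * n)) :=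
          hg.iterate_mono _ (H.c_mono_right hn hM1 hMr)
    _ = g^[(r + 1) + 13] (g^[r + 1] (c n ((r + 1) * n))) := by
          rw [← Function.iterate_add_apply]; congr 1; ring
    _ ≤ g^[(r + 1) + 13] (c n (2 * n)) := hg.iterate_mono _ (H.short_ge hg r hn)
    _ = g^[r + 1] (g^[13] (c n (2 * n))) := Function.iterate_add_apply g (r + 1) 13 _
    _ ≤ (g^[13] (c n (2 * n))) ^ (2 ^ (r + 1)) := hg.iterate_le_pow (r + 1) h13
    _ ≤ (g^[13] (c n (2 * n))) ^ (2 * r + 1) := pow_le_pow_of_le_one h13.1 h13.2 hpow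
    _ ≤ c (2 * n) n ^ (2 * r + 1) := pow_le_pow_left₀ h13.1 (H.long_ge hg hsmall hn) _
    _ ≤ c ((r + 1) * n) n := H.glue r n hn
    _ ≤ c M n := H.c_anti_left hM1 hMr hn

/-- **Theorem 1 (abstract form), the paper's setting `j₁ = 0`** (inputs at all scales, no separate
small-scale hypothesis): `P[𝓒(⌊ρn⌋, n)] ≥ g^[2⌈ρ⌉+13](P[𝓒(n, ⌊ρn⌋)])` for real `ρ ≥ 1`, `n ≥ 1`.
[cite: KohlerSchindlerTassion2023, Theorem 1 and §5.2] -/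
theorem thm1₀ (hg : IsAdmissible g) (H : SchemeHyp g 0 c c' a a' b b' q q') {ρ : ℝ} (hρ : 1 ≤ ρ)
    {n : ℕ} (hn : 1 ≤ n) : g^[2 * ⌈ρ⌉₊ + 13] (c n ⌊ρ * n⌋₊) ≤ c ⌊ρ * n⌋₊ n :=
  H.thm1 hg (fun n h1 h2 => False.elim (by rw [pow_zero] at h2; omega)) hρ hn

/-- **Theorem 1 (abstract form) in the shape of the tree's statement**: if the admissible `g` is the
restriction of a homeomorphism `G` of `[0, 1]`, then with the homeomorphism
`ψ_ρ := G^[2⌈ρ⌉ + 13]` (`KST2023.iterHomeo`), chosen in terms of `ρ` and `G` only,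
`ψ_ρ(P[𝓒(n, ⌊ρn⌋)]) ≤ P[𝓒(⌊ρn⌋, n)]` for all `n ≥ 1` (probabilities fed through `Set.projIcc 0 1`, the
identity on `[0, 1]`, exactly as in `KohlerSchindlerTassion2023_thm1`).
[cite: KohlerSchindlerTassion2023, Theorem 1] -/
theorem thm1_homeomorph (hg : IsAdmissible g) (H : SchemeHyp g j₁ c c' a a' b b' q q')
    (hsmall : ∀ n, 1 ≤ n → n < 4 ^ j₁ → g^[13] (c n (2 * n)) ≤ c (2 * n) n)
    (G : unitInterval ≃ₜ unitInterval) (hG : ∀ x : unitInterval, (G x : ℝ) = g x)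
    {ρ : ℝ} (hρ : 1 ≤ ρ) {n : ℕ} (hn : 1 ≤ n) :
    (iterHomeo G (2 * ⌈ρ⌉₊ + 13) (Set.projIcc (0 : ℝ) 1 zero_le_one (c n ⌊ρ * n⌋₊)) : ℝ) ≤
      c ⌊ρ * n⌋₊ n := by
  rw [coe_iterHomeo_apply_eq G hG, Set.projIcc_of_mem zero_le_one (H.c_mem _ _)]
  exact H.thm1 hg hsmall hρ hn

/-- **Theorem 1 (abstract form) with the paper's functions**: for `g = f_N = rootPow N` (`N ≥ 2`; the
paper has `N = 2000`), `ψ_ρ := f_N^[2⌈ρ⌉+13]` as the homeomorphism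
`iterHomeo (rootPowHomeo N _) (2⌈ρ⌉₊ + 13)` of `[0, 1]`. [cite: KohlerSchindlerTassion2023, Theorem 1] -/
theorem thm1_rootPow {N : ℕ} (hN : 2 ≤ N) (H : SchemeHyp (rootPow N) j₁ c c' a a' b b' q q')
    (hsmall : ∀ n, 1 ≤ n → n < 4 ^ j₁ → (rootPow N)^[13] (c n (2 * n)) ≤ c (2 * n) n)
    {ρ : ℝ} (hρ : 1 ≤ ρ) {n : ℕ} (hn : 1 ≤ n) :
    (iterHomeo (rootPowHomeo N (by omega)) (2 * ⌈ρ⌉₊ + 13)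
        (Set.projIcc (0 : ℝ) 1 zero_le_one (c n ⌊ρ * n⌋₊)) : ℝ) ≤ c ⌊ρ * n⌋₊ n :=
  H.thm1_homeomorph (isAdmissible_rootPow hN) hsmall _ (coe_rootPowHomeo (by omega)) hρ hn

/-- **The universal homeomorphism is chosen before the data** (the quantifier order of Theorem 1,
"For every `ρ ≥ 1`, there exists a homeomorphism `ψ_ρ` such that for every … measure … and all
`n ≥ 1`"): for `N ≥ 2`, `j₁` and `ρ ≥ 1` there is ONE homeomorphism `ψ` of `[0,1]` that works for every
system of inputs `SchemeHyp (rootPow N) j₁ …` (with the small-scale inequality below `4^{j₁}`).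
[cite: KohlerSchindlerTassion2023, Theorem 1] -/
theorem exists_homeomorph {N : ℕ} (hN : 2 ≤ N) (j₁ : ℕ) {ρ : ℝ} (hρ : 1 ≤ ρ) :
    ∃ ψ : unitInterval ≃ₜ unitInterval,
      ∀ (c c' : ℕ → ℕ → ℝ) (a a' b b' : ℕ → ℝ) (q q' : ℕ → ℕ → ℝ),
        SchemeHyp (rootPow N) j₁ c c' a a' b b' q q' →
        (∀ n, 1 ≤ n → n < 4 ^ j₁ → (rootPow N)^[13] (c n (2 * n)) ≤ c (2 * n) n) →
          ∀ n, 1 ≤ n → (ψ (Set.projIcc (0 : ℝ) 1 zero_le_one (c n ⌊ρ * n⌋₊)) : ℝ) ≤ c ⌊ρ * n⌋₊ n :=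
  ⟨iterHomeo (rootPowHomeo N (by omega)) (2 * ⌈ρ⌉₊ + 13), fun _ _ _ _ _ _ _ _ H hsmall _ hn =>
    H.thm1_rootPow hN hsmall hρ hn⟩

end SchemeHyp

end

end KST2023

end Literature.Probability.Percolation
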